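/-
HONEST FRAMING: certified error envelopes and provably optimal rounding/accumulation schemes for
low-precision formats under stated cost models; every table by two implementations; no hardware
or vendor claims.
-/
import Summits.Ventures.CertifiedArithmetic.LowPrec.OptDemotionBudgetCert8A
import Summits.Ventures.CertifiedArithmetic.LowPrec.OptDemotionBudgetCert8B
import Summits.Ventures.CertifiedArithmetic.LowPrec.OptDemotionBudgetCert8C

/-!
# The demotion law (Theorem T8), part 7f: Conjecture D at (q,p) = (4,2) for EVERY tree with at most EIGHT summands

Blocks 15–19 of the kernel certificates for the 429 ordered shapes with 8 leaves (parts 7f(A)–(C)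
have blocks 0–14), their reassembly `budgetCheck_4_2_eight`, the certificate
`budgetCheck_4_2_upTo8` for ALL 626 ordered shapes with at most 8 leaves, and
**`conjectureD_4_2_of_le_eight`**: `s ≤ Q_t · fl_p(ŝ)` for every summation tree with at most 8
summands, any nearest roundings into `F(4, emin)` / `F(2, emin)`, any nonnegative `F(4, emin)` data
(with part 4's witness: `D_t = Q_t` exactly).  All by `decide +kernel` (standard axioms).
-/

namespace Summit.Ventures.CertifiedArithmetic.LowPrec.Opt

open Literature.ComputerArithmetic.JeannerodRump2018
open Literature.ComputerArithmetic.JeannerodRump2018.SumTree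

/-- (4,2), the 429 shapes with 8 leaves, block 15 (shapes 330–351). -/
theorem budgetCheck_4_2_eight_15 : (chunk (shapesN 8) 22 15).all (budgetCheck 4 2) = true := by
  decide +kernel

/-- (4,2), the 429 shapes with 8 leaves, block 16 (shapes 352–373). -/
theorem budgetCheck_4_2_eight_16 : (chunk (shapesN 8) 22 16).all (budgetCheck 4 2) = true := by
  decide +kernel

/-- (4,2), the 429 shapes with 8 leaves, block 17 (shapes 374–395). -/
theorem budgetCheck_4_2_eight_17 : (chunk (shapesN 8) 22 17).all (budgetCheck 4 2) = true := by
  decide +kernel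

/-- (4,2), the 429 shapes with 8 leaves, block 18 (shapes 396–417). -/
theorem budgetCheck_4_2_eight_18 : (chunk (shapesN 8) 22 18).all (budgetCheck 4 2) = true := by
  decide +kernel

/-- (4,2), the 429 shapes with 8 leaves, block 19 (shapes 418–428). -/
theorem budgetCheck_4_2_eight_19 : (chunk (shapesN 8) 22 19).all (budgetCheck 4 2) = true := by
  decide +kernel

/-- (4,2): all 429 shapes with 8 leaves pass. -/
theorem budgetCheck_4_2_eight : (shapesN 8).all (budgetCheck 4 2) = true :=
  all_of_chunks _ _ 22 20 (by norm_num) (by decide +kernel)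
    (by
      have c := chunks_succ (chunks_succ (chunks_succ (chunks_succ (chunks_succ chunks_zero
        budgetCheck_4_2_eight_0) budgetCheck_4_2_eight_1) budgetCheck_4_2_eight_2)
        budgetCheck_4_2_eight_3) budgetCheck_4_2_eight_4
      have c := chunks_succ (chunks_succ (chunks_succ (chunks_succ (chunks_succ c
        budgetCheck_4_2_eight_5) budgetCheck_4_2_eight_6) budgetCheck_4_2_eight_7)
        budgetCheck_4_2_eight_8) budgetCheck_4_2_eight_9
      have c := chunks_succ (chunks_succ (chunks_succ (chunks_succ (chunks_succ c
        budgetCheck_4_2_eight_10) budgetCheck_4_2_eight_11) budgetCheck_4_2_eight_12)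
        budgetCheck_4_2_eight_13) budgetCheck_4_2_eight_14
      exact chunks_succ (chunks_succ (chunks_succ (chunks_succ (chunks_succ c
        budgetCheck_4_2_eight_15) budgetCheck_4_2_eight_16) budgetCheck_4_2_eight_17)
        budgetCheck_4_2_eight_18) budgetCheck_4_2_eight_19)

/-- (4,2): EVERY shape with at most 8 leaves passes (626 ordered shapes). -/
theorem budgetCheck_4_2_upTo8 : (shapesUpTo 8).all (budgetCheck 4 2) = true :=
  all_shapesUpTo_succ budgetCheck_4_2_upTo7 budgetCheck_4_2_eight

/-- **CONJECTURE D AT (q,p) = (4,2) FOR EVERY TREE WITH AT MOST 8 SUMMANDS**: any nearest roundings,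
nonnegative `F(4, emin)` data, `s ≤ Q_t · fl_p(ŝ)`. -/
theorem conjectureD_4_2_of_le_eight {emin : ℤ} {fl flp : ℚ → ℚ}
    (hfl : IsRoundNearest 4 emin fl) (hflp : IsRoundNearest 2 emin flp)
    (t : SumTree) (ht : ∀ x ∈ leaves t, IsFloat 4 emin x ∧ 0 ≤ x) (hn : (leaves t).length ≤ 8) :
    exact t ≤ treeQf (unitRoundoff 4) t (unitRoundoff 2) * flp (eval fl t) :=
  exact_le_treeQf_mul_fl_of_budgetCheck (by norm_num) (by norm_num) hfl hflp t ht
    (budgetCheck_of_all budgetCheck_4_2_upTo8 t hn)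

end Summit.Ventures.CertifiedArithmetic.LowPrec.Opt
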